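import Literature.NumberTheory.GelbartRogawski1991.DoubledWeilRepresentationUndoublingConj
import Literature.NumberTheory.Weil1964.AdelicMetaplecticSeesawConjugate
import Literature.NumberTheory.Weil1964.AdelicMetaplecticSeesawSum
import HarnessLib

/-!
# Undoubling commutes with the rational-lift conjugation: the undoubled splitting of a conjugated doubled Weil homomorphism
# is the conjugated undoubled splitting (cell `hodgecm-mathlib`, GS-6 (β) node (T), piece (T4u); placement row L-13b)

Precedent: ★ `DoubledWeilRepresentationUndoublingConj.undouble_relabel_comp_conjH` (the relabel-only case `r = 1`).

* §A THE ABSTRACT LEMMA — **`undouble_conjSplitting_comp`**.  Doubled data at TWO `V`-frames `dV`, `dV′` (same `e`, `dW`): a homomorphism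
  `sD : H(𝔸) →* Mp(𝕎^𝔻[dV])ᶜᵒⁿᵗ` over `ι^𝔻` (`hproj`), a DOUBLED conjugation datum `(rD, CD, hCD, θD)` with
  `conjSplitting (Fp L) (Fin (n+n)) rD CD hCD (sD ∘ θD)` over `ι′^𝔻` (`hproj′`), an UNDOUBLED conjugation datum `(r, C, hC, θ)` over the
  see-saw square `hsq` (read through `e`), and TWO COMPATIBILITIES: (u1) `θD (g′ ⊕ 1) = (θ g′) ⊕ 1` (`hθ`) and (u2)
  `ω(undoubleIdx rD) (Φ₁ ⊠ Φ₂) = ω(r) Φ₁ ⊠ B Φ₂` for some linear automorphism `B` (`hrD`).  THEN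
  `undouble[dV′] (conjSplitting rD CD hCD (sD ∘ θD)) g′ = conjSplitting r C hC (undoubleHom[dV] sD ∘ θ) g′` — by ★ `undouble_unique`:
  (a) `π` by ★ `proj_conjSplitting_eq` from `hsq`; (b) the product formula: `Ad(ω(undoubleIdx rD))` intertwines `ω(u′ g′)` and `ω(u(θ g′))`
  (★ `omega_undoubleIdx_apply`, ★ `omega_apply_omega_conjSplitting`, `hθ`), then (u2) + ★ `omega_uD_tensorToSum` +
  ★ `omega_apply_omega_conjSplitting` at `Fin n`, and injectivity of `ω(undoubleIdx rD)` (`omega_undoubleIdx_injective`,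
  `omega_undoubleIdx_omega_uD_conjSplitting`).
* §B (u2) FOR Θ-FIXING TRIPLES — **`omega_undoubleIdx_tensorToSum_of_mem_adelicMpTheta`**: if `undoubleIdx rD`, `r`, `r⁻` are `Θ`-fixing and
  `π(undoubleIdx rD) = π(r) ⊕ π(r⁻)`, then `ω(undoubleIdx rD)(Φ₁ ⊠ Φ₂) = ω(r)Φ₁ ⊠ ω(r⁻)Φ₂` ON THE NOSE (★ `mpSeesawChar_eq_one_of_mem_adelicMpTheta`
  / ★ `mpSeesawChar_spec` on the equaliser subgroup of `Mp(𝕎⊕𝕎⁻) × (Mp(𝕎) × Mp(𝕎⁻))` where `π = π₁ ⊕ π₂`).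

The model instantiation of `(rD, CD, θD)` and `(r, C, θ, r⁻)` with (u1), `hsq`, `hπ` discharged (doubled Kronecker matrix `M̃ ⊕ M̃` of a
rational isometry, Weil's Θ-fixing lifts) is the companion file of the (T1ᴰ) lineage.  Theorems only (no definition, no named fact).
Phase-A bytes of record: `A-plan/gs6-glue/T4u-undoublingConj.A-p06g11.lean` sha16 e96f661a7c726c96 (A-p06 g11), declarations byte-identical
up to (i) one docstring tag `[folklore]` → `[cite: Weil1964, Chap. III n° 37 p. 188]` on `omega_undoubleIdx_injective` and (ii) the local
notation `𝔸⁺` expanded to `(AdeleRing (𝓞 (Fp L)) (Fp L))` (no notation declared in a Literature file).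
HC_CM is proved only modulo the 7 printed citations until rung 0 closes.

## References

* [Kudla1994] S. S. Kudla, *Splitting metaplectic covers of dual reductive pairs*, Israel J. Math. 87 (1994) 361–401, §2 (the doubled
  space and its Siegel parabolic), Thm. 3.1.
* [Kudla1984] S. Kudla, *Seesaw dual reductive pairs*, Progr. Math. 46 (1984), §1.
* [GelbartRogawski1991] S. Gelbart, J. Rogawski, Invent. Math. 105 (1991), §3.1 p. 454, Prop. 3.1.1 p. 455.
* [Weil1964] A. Weil, *Sur certains groupes d'opérateurs unitaires*, Acta Math. 111 (1964), Chap. III n° 37 p. 188 (`𝐫_𝐀` by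
  automorphisms), n° 40 p. 190, n° 41 Thm 6 p. 193 (rational lifts fix `Θ`).
* [MoeglinVignerasWaldspurger1987] C. Mœglin, M.-F. Vignéras, J.-L. Waldspurger, LNM 1291 (1987), Chap. 2 II.1.
-/

set_option autoImplicit false

noncomputable section

open scoped Classical
open scoped Matrix Kronecker
open NumberField IsDedekindDomain
open Literature.RepresentationTheory.HeisenbergGroup
open Literature.NumberTheory.Automorphic
open Literature.NumberTheory.Weil1964
open Literature.NumberTheory.GaloisRepresentations

namespace Literature.NumberTheory.GelbartRogawski1991.GRConstruction

open UnitaryDualPair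
open Literature.NumberTheory.Automorphic.UnitaryGroup

variable {L : Type} [Field L] [NumberField L] [IsCMField L]
  {N M n : ℕ} {e : Fin N × Fin M ≃ Fin n}
  {dV : Fin N → L} {hdV : ∀ i, IsCMField.complexConj L (dV i) = dV i} {hdV0 : ∀ i, dV i ≠ 0}
  {dV' : Fin N → L} {hdV' : ∀ i, IsCMField.complexConj L (dV' i) = dV' i} {hdV'0 : ∀ i, dV' i ≠ 0}
  {dW : Fin M → L} {hdW : ∀ i, IsCMField.complexConj L (dW i) = dW i} {hdW0 : ∀ i, dW i ≠ 0}

/-! ## §A The abstract lemma: undoubling commutes with `conjSplitting` -/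

section Abstract

/-- `ω(q⁻¹) (ω(q) Ψ) = Ψ` for the doubled index change (injectivity of `ω(undoubleIdx rD)`). [cite: Weil1964, Chap. III n° 37 p. 188] -/
theorem omega_undoubleIdx_injective (rD : MpD L e dV hdV dW hdW) :
    Function.Injective (adelicMpCont.omega (Fp L) (Fin n ⊕ Fin n) (gramS L e dV hdV dW hdW) (undoubleIdx L e dV hdV dW hdW rD)) :=
  fun X Y h =>
    ((map_inv_apply_map_apply
        (adelicMpCont.omega (Fp L) (Fin n ⊕ Fin n) (gramS L e dV hdV dW hdW)) (undoubleIdx L e dV hdV dW hdW rD) X).symm.trans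
      ((congrArg (adelicMpCont.omega (Fp L) (Fin n ⊕ Fin n) (gramS L e dV hdV dW hdW) (undoubleIdx L e dV hdV dW hdW rD)⁻¹) h).trans
        (map_inv_apply_map_apply
          (adelicMpCont.omega (Fp L) (Fin n ⊕ Fin n) (gramS L e dV hdV dW hdW)) (undoubleIdx L e dV hdV dW hdW rD) Y)))

/-- **THE INTERTWINING**: `ω(undoubleIdx rD) (ω(u′ g′) Ψ) = ω(u (θ g′)) (ω(undoubleIdx rD) Ψ)` for `u′ = uD[dV′] (conjSplitting rD CD hCD (sD ∘ θD))`,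
`u = uD[dV] sD`, from (u1) `θD (g′ ⊕ 1) = θ g′ ⊕ 1`. [cite: Kudla1994, §2 (doubled space, Siegel parabolic), Thm. 3.1] -/
theorem omega_undoubleIdx_omega_uD_conjSplitting {sD : HA L e dV hdV dW hdW →* MpD L e dV hdV dW hdW}
    (rD : MpD L e dV hdV dW hdW) (CD : GL (Fin (n + n)) (AdeleRing (𝓞 (Fp L)) (Fp L)))
    (hCD : gramDA L e dV hdV dW hdW * (CD : Matrix (Fin (n + n)) (Fin (n + n)) (AdeleRing (𝓞 (Fp L)) (Fp L))) = gramDA L e dV' hdV' dW hdW)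
    (θD : HA L e dV' hdV' dW hdW →* HA L e dV hdV dW hdW)
    (θ : adelicPair (Fp L) L (IsCMField.complexConj L) N M (Matrix.diagonal dV') (Matrix.diagonal dW) →*
      adelicPair (Fp L) L (IsCMField.complexConj L) N M (Matrix.diagonal dV) (Matrix.diagonal dW))
    (hθ : ∀ g', θD (inlG L e dV' hdV' dW hdW g') = inlG L e dV hdV dW hdW (θ g'))
    (g' : adelicPair (Fp L) L (IsCMField.complexConj L) N M (Matrix.diagonal dV') (Matrix.diagonal dW))
    (Ψ : piSchwartzBruhat (Fp L) (Fin n ⊕ Fin n)) :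
    adelicMpCont.omega (Fp L) (Fin n ⊕ Fin n) (gramS L e dV hdV dW hdW) (undoubleIdx L e dV hdV dW hdW rD)
        (adelicMpCont.omega (Fp L) (Fin n ⊕ Fin n) (gramS L e dV' hdV' dW hdW)
          (uD L e dV' hdV' dW hdW (conjSplitting (Fp L) (Fin (n + n)) rD CD hCD (sD.comp θD)) g') Ψ) =
      adelicMpCont.omega (Fp L) (Fin n ⊕ Fin n) (gramS L e dV hdV dW hdW) (uD L e dV hdV dW hdW sD (θ g'))
        (adelicMpCont.omega (Fp L) (Fin n ⊕ Fin n) (gramS L e dV hdV dW hdW) (undoubleIdx L e dV hdV dW hdW rD) Ψ) := by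
  -- notation: `R = R_{e₂⁻¹}`, `U = ω(undoubleIdx rD)`, `q = conjSplitting rD CD hCD (sD ∘ θD) (g′ ⊕ 1)`
  have e1 := omega_undoubleIdx_apply (e := e) (dV := dV') (hdV := hdV') dW hdW
    (conjSplitting (Fp L) (Fin (n + n)) rD CD hCD (sD.comp θD) (inlG L e dV' hdV' dW hdW g')) Ψ
  have e2 := omega_undoubleIdx_apply (e := e) (dV := dV) (hdV := hdV) dW hdW rD
    (piSBReindex (Fp L) (e₂ (n := n)).symm
      (adelicMpCont.omega (Fp L) (Fin (n + n)) (gramDA L e dV' hdV' dW hdW)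
        (conjSplitting (Fp L) (Fin (n + n)) rD CD hCD (sD.comp θD) (inlG L e dV' hdV' dW hdW g'))
        ((piSBReindex (Fp L) (e₂ (n := n)).symm).symm Ψ)))
  have e3 := (piSBReindex (Fp L) (e₂ (n := n)).symm).symm_apply_apply
    (adelicMpCont.omega (Fp L) (Fin (n + n)) (gramDA L e dV' hdV' dW hdW)
      (conjSplitting (Fp L) (Fin (n + n)) rD CD hCD (sD.comp θD) (inlG L e dV' hdV' dW hdW g'))
      ((piSBReindex (Fp L) (e₂ (n := n)).symm).symm Ψ))
  have e4 := omega_apply_omega_conjSplitting (Fp L) (Fin (n + n)) rD CD hCD (sD.comp θD)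
    (inlG L e dV' hdV' dW hdW g') ((piSBReindex (Fp L) (e₂ (n := n)).symm).symm Ψ)
  have e5 : (sD.comp θD) (inlG L e dV' hdV' dW hdW g') = sD (inlG L e dV hdV dW hdW (θ g')) := congrArg sD (hθ g')
  have e6 := omega_undoubleIdx_apply (e := e) (dV := dV) (hdV := hdV) dW hdW (sD (inlG L e dV hdV dW hdW (θ g')))
    (adelicMpCont.omega (Fp L) (Fin n ⊕ Fin n) (gramS L e dV hdV dW hdW) (undoubleIdx L e dV hdV dW hdW rD) Ψ)
  have e7 := omega_undoubleIdx_apply (e := e) (dV := dV) (hdV := hdV) dW hdW rD Ψ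
  have e7' : (piSBReindex (Fp L) (e₂ (n := n)).symm).symm
      (adelicMpCont.omega (Fp L) (Fin n ⊕ Fin n) (gramS L e dV hdV dW hdW) (undoubleIdx L e dV hdV dW hdW rD) Ψ) =
      adelicMpCont.omega (Fp L) (Fin (n + n)) (gramDA L e dV hdV dW hdW) rD ((piSBReindex (Fp L) (e₂ (n := n)).symm).symm Ψ) :=
    (congrArg (piSBReindex (Fp L) (e₂ (n := n)).symm).symm e7).trans
      ((piSBReindex (Fp L) (e₂ (n := n)).symm).symm_apply_apply _)
  -- LHS chain
  have lhs := (congrArg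
      (adelicMpCont.omega (Fp L) (Fin n ⊕ Fin n) (gramS L e dV hdV dW hdW) (undoubleIdx L e dV hdV dW hdW rD)) e1).trans
    (e2.trans ((congrArg (fun X => piSBReindex (Fp L) (e₂ (n := n)).symm
        (adelicMpCont.omega (Fp L) (Fin (n + n)) (gramDA L e dV hdV dW hdW) rD X)) e3).trans
      ((congrArg (piSBReindex (Fp L) (e₂ (n := n)).symm) e4).trans
        (congrArg (fun m : MpD L e dV hdV dW hdW => piSBReindex (Fp L) (e₂ (n := n)).symm
          (adelicMpCont.omega (Fp L) (Fin (n + n)) (gramDA L e dV hdV dW hdW) m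
            (adelicMpCont.omega (Fp L) (Fin (n + n)) (gramDA L e dV hdV dW hdW) rD
              ((piSBReindex (Fp L) (e₂ (n := n)).symm).symm Ψ)))) e5))))
  -- RHS chain
  have rhs := e6.trans (congrArg (fun Y => piSBReindex (Fp L) (e₂ (n := n)).symm
      (adelicMpCont.omega (Fp L) (Fin (n + n)) (gramDA L e dV hdV dW hdW) (sD (inlG L e dV hdV dW hdW (θ g'))) Y)) e7')
  exact lhs.trans rhs.symm

/-- **(T4u) — UNDOUBLING COMMUTES WITH THE CONJUGATION**: with the data of the module docstring,
`undouble[dV′] (conjSplitting rD CD hCD (sD ∘ θD)) g′ = conjSplitting r C hC (undoubleHom[dV] sD ∘ θ) g′`.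
[cite: Kudla1994, §2 (doubled space, Siegel parabolic), Thm. 3.1] [cite: GelbartRogawski1991, §3.1 p. 454] [cite: Weil1964, Chap. III n° 40 p. 190] -/
theorem undouble_conjSplitting_comp {sD : HA L e dV hdV dW hdW →* MpD L e dV hdV dW hdW}
    (hproj : ∀ h, projD L e dV hdV dW hdW (sD h) = toSpD L e dV hdV dW hdW h)
    (rD : MpD L e dV hdV dW hdW) (CD : GL (Fin (n + n)) (AdeleRing (𝓞 (Fp L)) (Fp L)))
    (hCD : gramDA L e dV hdV dW hdW * (CD : Matrix (Fin (n + n)) (Fin (n + n)) (AdeleRing (𝓞 (Fp L)) (Fp L))) = gramDA L e dV' hdV' dW hdW)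
    (θD : HA L e dV' hdV' dW hdW →* HA L e dV hdV dW hdW)
    (hproj' : ∀ h, projD L e dV' hdV' dW hdW (conjSplitting (Fp L) (Fin (n + n)) rD CD hCD (sD.comp θD) h) =
      toSpD L e dV' hdV' dW hdW h)
    (θ : adelicPair (Fp L) L (IsCMField.complexConj L) N M (Matrix.diagonal dV') (Matrix.diagonal dW) →*
      adelicPair (Fp L) L (IsCMField.complexConj L) N M (Matrix.diagonal dV) (Matrix.diagonal dW))
    (hθ : ∀ g', θD (inlG L e dV' hdV' dW hdW g') = inlG L e dV hdV dW hdW (θ g'))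
    (r : adelicMpCont (Fp L) (Fin n) (gramA L e dV hdV dW hdW)) (C : GL (Fin n) (AdeleRing (𝓞 (Fp L)) (Fp L)))
    (hC : gramA L e dV hdV dW hdW * (C : Matrix (Fin n) (Fin n) (AdeleRing (𝓞 (Fp L)) (Fp L))) = gramA L e dV' hdV' dW hdW)
    (hsq : ∀ g', adelicMpCont.proj (Fp L) (Fin n) (gramA L e dV hdV dW hdW) r *
        symplecticGroupCongr (polar (adelicForm (Fp L) (Fin n) (gramA L e dV' hdV' dW hdW)))
          (polar (adelicForm (Fp L) (Fin n) (gramA L e dV hdV dW hdW)))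
          (relabelVec (Fp L) (Fin n) C) (polar_relabelVec (Fp L) (Fin n) C hC) ((D L e dV' hdV' hdV'0 dW hdW hdW0).toSp g') *
      (adelicMpCont.proj (Fp L) (Fin n) (gramA L e dV hdV dW hdW) r)⁻¹ = (D L e dV hdV hdV0 dW hdW hdW0).toSp (θ g'))
    (B : piSchwartzBruhat (Fp L) (Fin n) ≃ₗ[ℂ] piSchwartzBruhat (Fp L) (Fin n))
    (hrD : ∀ Φ₁ Φ₂ : piSchwartzBruhat (Fp L) (Fin n),
      adelicMpCont.omega (Fp L) (Fin n ⊕ Fin n) (gramS L e dV hdV dW hdW) (undoubleIdx L e dV hdV dW hdW rD)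
          (tensorToSum (Fp L) (Fin n) (Fin n) Φ₁ Φ₂) =
        tensorToSum (Fp L) (Fin n) (Fin n) (adelicMpCont.omega (Fp L) (Fin n) (gramA L e dV hdV dW hdW) r Φ₁) (B Φ₂))
    (g' : adelicPair (Fp L) L (IsCMField.complexConj L) N M (Matrix.diagonal dV') (Matrix.diagonal dW)) :
    undouble L e dV' hdV' hdV'0 dW hdW hdW0 hproj' g' =
      conjSplitting (Fp L) (Fin n) r C hC ((undoubleHom L e dV hdV hdV0 dW hdW hdW0 sD hproj).comp θ) g' := by
  symm
  refine undouble_unique L e dV' hdV' hdV'0 dW hdW hdW0 hproj' g' _ ?_ fun Φ₁ Φ₂ => ?_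
  · -- (a) `π`
    exact proj_conjSplitting_eq (Fp L) (Fin n) r C hC ((undoubleHom L e dV hdV hdV0 dW hdW hdW0 sD hproj).comp θ)
      (fun q => (D L e dV' hdV' hdV'0 dW hdW hdW0).toSp q)
      (fun q => (hsq q).trans (proj_undouble L e dV hdV hdV0 dW hdW hdW0 hproj (θ q)).symm) g'
  · -- (b) the product formula, by injectivity of `U := ω(undoubleIdx rD)`
    apply omega_undoubleIdx_injective rD
    refine (omega_undoubleIdx_omega_uD_conjSplitting rD CD hCD θD θ hθ g' _).trans ?_
    exact ((congrArg (adelicMpCont.omega (Fp L) (Fin n ⊕ Fin n) (gramS L e dV hdV dW hdW) (uD L e dV hdV dW hdW sD (θ g')))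
        (hrD Φ₁ Φ₂)).trans (omega_uD_tensorToSum L e dV hdV hdV0 dW hdW hdW0 hproj (θ g') _ (B Φ₂))).trans
      (((congrArg (fun X => tensorToSum (Fp L) (Fin n) (Fin n) X (B Φ₂))
          (omega_apply_omega_conjSplitting (Fp L) (Fin n) r C hC
            ((undoubleHom L e dV hdV hdV0 dW hdW hdW0 sD hproj).comp θ) g' Φ₁)).symm).trans
        (hrD _ Φ₂).symm)

end Abstract

/-! ## §B (u2): the doubled index change of a Θ-fixing element over `π(r) ⊕ π(r⁻)` is `ω(r) ⊠ ω(r⁻)` on the nose -/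

section Theta

/-- **(u2)**: if `undoubleIdx rD` lies over `π(r) ⊕ π(r⁻)` and `undoubleIdx rD`, `r`, `r⁻` are `Θ`-fixing, then
`ω(undoubleIdx rD)(Φ₁ ⊠ Φ₂) = ω(r)Φ₁ ⊠ ω(r⁻)Φ₂` (the see-saw character of a `Θ`-fixing triple is `1`).
[cite: Weil1964, Chap. III n° 41 Thm 6 p. 193] [cite: Kudla1984, §1] -/
theorem omega_undoubleIdx_tensorToSum_of_mem_adelicMpTheta (rD : MpD L e dV hdV dW hdW)
    (r : adelicMpCont (Fp L) (Fin n) (gramA L e dV hdV dW hdW)) (rneg : adelicMpCont (Fp L) (Fin n) (-gramA L e dV hdV dW hdW))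
    (hπ : adelicMpCont.proj (Fp L) (Fin n ⊕ Fin n) (gramS L e dV hdV dW hdW) (undoubleIdx L e dV hdV dW hdW rD) =
      spSum (gramA L e dV hdV dW hdW) (-gramA L e dV hdV dW hdW)
        (adelicMpCont.proj (Fp L) (Fin n) (gramA L e dV hdV dW hdW) r,
          adelicMpCont.proj (Fp L) (Fin n) (-gramA L e dV hdV dW hdW) rneg))
    (hθD : ((undoubleIdx L e dV hdV dW hdW rD : adelicMpCont (Fp L) (Fin n ⊕ Fin n) (gramS L e dV hdV dW hdW)) :
      adelicMp (Fp L) (Fin n ⊕ Fin n) (gramS L e dV hdV dW hdW)) ∈ adelicMpTheta (Fp L) (Fin n ⊕ Fin n) (gramS L e dV hdV dW hdW))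
    (hθ₁ : (r : adelicMp (Fp L) (Fin n) (gramA L e dV hdV dW hdW)) ∈ adelicMpTheta (Fp L) (Fin n) (gramA L e dV hdV dW hdW))
    (hθ₂ : (rneg : adelicMp (Fp L) (Fin n) (-gramA L e dV hdV dW hdW)) ∈ adelicMpTheta (Fp L) (Fin n) (-gramA L e dV hdV dW hdW))
    (hdV0 : ∀ i, dV i ≠ 0) (hdW0 : ∀ i, dW i ≠ 0)
    (Φ₁ Φ₂ : piSchwartzBruhat (Fp L) (Fin n)) :
    adelicMpCont.omega (Fp L) (Fin n ⊕ Fin n) (gramS L e dV hdV dW hdW) (undoubleIdx L e dV hdV dW hdW rD)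
        (tensorToSum (Fp L) (Fin n) (Fin n) Φ₁ Φ₂) =
      tensorToSum (Fp L) (Fin n) (Fin n) (adelicMpCont.omega (Fp L) (Fin n) (gramA L e dV hdV dW hdW) r Φ₁)
        (adelicMpCont.omega (Fp L) (Fin n) (-gramA L e dV hdV dW hdW) rneg Φ₂) := by
  -- run the three elements through the EQUALISER subgroup of `Mp(𝕎⊕𝕎⁻) × (Mp(𝕎) × Mp(𝕎⁻))` on which `π = π₁ ⊕ π₂`
  -- (all values DEFINITIONAL, so the Θ-hypotheses apply verbatim), and use the see-saw character of that subgroup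
  let P₀ := adelicMpCont (Fp L) (Fin n ⊕ Fin n) (gramS L e dV hdV dW hdW) ×
    (adelicMpCont (Fp L) (Fin n) (gramA L e dV hdV dW hdW) × adelicMpCont (Fp L) (Fin n) (-gramA L e dV hdV dW hdW))
  let f : P₀ →* _ := (adelicMpCont.proj (Fp L) (Fin n ⊕ Fin n) (gramS L e dV hdV dW hdW)).comp (MonoidHom.fst _ _)
  let g : P₀ →* _ := (spSum (gramA L e dV hdV dW hdW) (-gramA L e dV hdV dW hdW)).comp
    (((adelicMpCont.proj (Fp L) (Fin n) (gramA L e dV hdV dW hdW)).comp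
        ((MonoidHom.fst _ _).comp (MonoidHom.snd _ _))).prod
      ((adelicMpCont.proj (Fp L) (Fin n) (-gramA L e dV hdV dW hdW)).comp
        ((MonoidHom.snd _ _).comp (MonoidHom.snd _ _))))
  let K := MonoidHom.eqLocus f g
  let s := (MonoidHom.fst _ _).comp K.subtype
  let s₁ := ((MonoidHom.fst _ _).comp (MonoidHom.snd _ _)).comp K.subtype
  let s₂ := ((MonoidHom.snd _ _).comp (MonoidHom.snd _ _)).comp K.subtype
  have hs : ∀ k : K, adelicMpCont.proj (Fp L) (Fin n ⊕ Fin n) (gramS L e dV hdV dW hdW) (s k) =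
      spSum (gramA L e dV hdV dW hdW) (-gramA L e dV hdV dW hdW)
        (adelicMpCont.proj (Fp L) (Fin n) (gramA L e dV hdV dW hdW) (s₁ k),
          adelicMpCont.proj (Fp L) (Fin n) (-gramA L e dV hdV dW hdW) (s₂ k)) := fun k => k.2
  let t : K := ⟨(undoubleIdx L e dV hdV dW hdW rD, (r, rneg)), hπ⟩
  have hχ := mpSeesawChar_eq_one_of_mem_adelicMpTheta s s₁ s₂ hs (isUnit_gramA L e dV hdV hdV0 dW hdW hdW0)
    (isUnit_gramA L e dV hdV hdV0 dW hdW hdW0).neg (p := t) hθD hθ₁ hθ₂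
  have hspec := mpSeesawChar_spec s s₁ s₂ hs (isUnit_gramA L e dV hdV hdV0 dW hdW hdW0)
    (isUnit_gramA L e dV hdV hdV0 dW hdW hdW0).neg t Φ₁ Φ₂
  exact hspec.trans ((congrArg (fun c : ℂˣ => (c : ℂ) •
      tensorToSum (Fp L) (Fin n) (Fin n) (adelicMpCont.omega (Fp L) (Fin n) (gramA L e dV hdV dW hdW) r Φ₁)
        (adelicMpCont.omega (Fp L) (Fin n) (-gramA L e dV hdV dW hdW) rneg Φ₂)) hχ).trans
    ((congrArg (· • _) Units.val_one).trans (one_smul ℂ _)))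

end Theta

end Literature.NumberTheory.GelbartRogawski1991.GRConstruction

end
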